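import Literature.AlgebraicGeometry.ModuliOfAbelianVarieties.SiegelFamilyNoetherLefschetzLocus
import Literature.NumberTheory.ModularForms.SiegelPhiOperator
import HarnessLib

/-!
# The product locus `𝒜_{g−1} × 𝒜₁ → 𝒜_g` is a Noether–Lefschetz locus of type (i)
# (Canning–Oprea–Pandharipande 2024, p. 2 and Thm 13 (i); Klingen 1990 §5 (2))

Layer `Literature/AlgebraicGeometry/ModuliOfAbelianVarieties`, namespace
`Literature.AlgebraicGeometry.ModuliOfAbelianVarieties.SiegelModuli`; lane `lit-hodgefound` (Track 2 foundations
library, Layer A4), seat `lit-hodgefound-skel-4`, row **A4-73** of `run/shared/lean/pub/lit-hodgefound/SKELETON.md`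
(§A4-DETAIL), FILE 5 — sequel of FILE 2 `SiegelFamilyNoetherLefschetzLocus.lean` (`nlLocus`, `nonSimpleLocus`,
`abelianSubvarietyLocus g k`, the complement symmetry `abelianSubvarietyLocus_eq_of_add_eq`) and of p39's
`NumberTheory/ModularForms/SiegelPhiOperator.lean` (Klingen §5 (2): the block-diagonal points `(Z 0; 0 iλ) ∈ 𝔥_{n+1}`,
`SiegelModularForm.blockDiag1`, `isSymm_blockDiag1`, `posDef_blockDiag1`).  ONE small DEFINITION with body
(`prodPoint Z hτ`, the point `(Z 0; 0 τ)` of `𝔥_{n+1}` bundled over the subtype; two private plumbing defs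
`lastFrame`, `lastLift`) and THEOREMS; no named fact (D-0026, net debt 0).

## Sources, verbatim

* S. Canning, D. Oprea, R. Pandharipande (2024) [held `paper:arxiv-2408.08718`], p0002 L28: «The product map
  `𝒜₁ × 𝒜_{g−1} → 𝒜_g` is a Noether-Lefschetz locus with general Neron-Severi rank 2.»; §1.9 Thm. 13 (p0007 L18,
  L22): «(i) For each integer `1 ≤ k ≤ g/2`, the locus of principally polarized abelian varieties containing an
  abelian subvariety of dimension `k` such that the induced polarization is of a fixed degree. … The components in
  Theorem 13 (i) that arise when the induced polarization is principal are exactly the product loci `𝒜_k × 𝒜_{g−k}`.»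
* H. Klingen, *Introductory lectures on Siegel modular forms* (1990), §5 Prop. 1 (2) (p. 55): the points
  `(z* 0; 0 iλ) ∈ H_{n+1}` for `z* ∈ H_n`, `λ > 0` (tree: `blockDiag1_mem`).

## What is proved

* §1 DEFINITION `prodPoint Z hτ ∈ 𝔥_{n+1}` (the period point `(Z 0; 0 τ)` of `X_Z × E_τ`, any `τ` with
  `Im τ > 0`; Klingen's `(z* 0; 0 iλ)` is `τ = iλ`, `coe_prodPoint_I_mul`), its matrix `coe_prodPoint`, and the
  period map on the last lattice plane: `prinPeriod_prodPoint_single_inl_last` (`Φ(e_x) = τ·e_{n+1}`),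
  `prinPeriod_prodPoint_single_inr_last` (`Φ(e_y) = e_{n+1}`), `prinPeriod_prodPoint_smul_add_smul`
  (`Φ(a e_x + b e_y) = (aτ + b)·e_{n+1}`: the plane covers the complex line `0 × ℂ`).
* §2 **`prodPoint_mem_abelianSubvarietyLocus_one`** (`X_Z × E_τ ⊃ 0 × E_τ`, an abelian subvariety of dimension
  `1`: the lattice plane `ℝe_x ⊕ ℝe_y` is complex), **`prodPoint_mem_abelianSubvarietyLocus`** (dimension `n`, by
  the complement symmetry of FILE 2), **`prodPoint_mem_nonSimpleLocus`**, **`prodPoint_mem_nlLocus`** («`𝒜₁ ×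
  𝒜_{g−1} → 𝒜_g` is a Noether-Lefschetz locus»: every product point has `ρ ≥ 2`), `prodPoint_mem_inter`,
  `prodPoint_injective`.

## Not here

«general Néron–Severi rank 2» on the product locus (`ρ(X_Z × E) = ρ(X_Z) + 1 + rk Hom(X_Z, E) = 2` for very general
`(Z, λ)`), the induced-polarization degree and the converse «principal ⇒ product».

## References

* [CanningOpreaPandharipande2024] p. 2 and §1.9 Thm. 13 (i) (p. 7).
* [Klingen1990] §5 Prop. 1 (2) (p. 55).
* [Lange2023AbelianVarietiesComplex] §3.1.1 (the period map `(x, y) ↦ Zx + y`, p. 157).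
-/

noncomputable section

open Matrix Module Function Set Filter Complex
open scoped Topology

namespace Literature.AlgebraicGeometry.ModuliOfAbelianVarieties

namespace SiegelModuli

open Literature.NumberTheory.Automorphic (siegelUpperHalfSpace)
open Literature.NumberTheory.ModularForms.SiegelUpperHalfSpace
open Literature.NumberTheory.Automorphic (mem_siegelUpperHalfSpace_iff)
open Literature.NumberTheory.ModularForms.SiegelModularForm (blockDiag1 blockDiag1_apply_last_last
  blockDiag1_apply_castSucc_last isSymm_blockDiag1 map_im_blockDiag1 posDef_blockDiag1)
open Literature.Geometry.Kaehler Literature.Geometry.Kaehler.ComplexTorus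

variable {n : ℕ}

/-! ## §1 The product points `(Z, τ) ∈ 𝔥_{n+1}` and their period map on the last two lattice vectors -/

/-- **The point `(Z 0; 0 τ) ∈ 𝔥_{n+1}` of the product locus `𝒜_n × 𝒜₁`**: the period point of `X_Z × E_τ`
(`Z ∈ 𝔥_n`, `Im τ > 0`; Klingen's `(z* 0; 0 iλ)` for `τ = iλ`). [cite: Klingen1990, §5 Prop. 1 (2) (p. 55)]
[cite: CanningOpreaPandharipande2024, p. 2 ("𝒜₁ × 𝒜_{g−1} → 𝒜_g")] -/
def prodPoint (Z : siegelUpperHalfSpace n) {τ : ℂ} (hτ : 0 < τ.im) : siegelUpperHalfSpace (n + 1) :=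
  ⟨blockDiag1 (Z : Matrix (Fin n) (Fin n) ℂ) τ, by
    rw [mem_siegelUpperHalfSpace_iff]
    refine ⟨isSymm_blockDiag1 Z.2.1 τ, ?_⟩
    rw [map_im_blockDiag1]
    exact posDef_blockDiag1 Z.2.2 hτ⟩

/-- The matrix of the product point. [cite: Klingen1990, §5 Prop. 1 (2) (p. 55)] -/
@[simp] theorem coe_prodPoint (Z : siegelUpperHalfSpace n) {τ : ℂ} (hτ : 0 < τ.im) :
    ((prodPoint Z hτ : siegelUpperHalfSpace (n + 1)) : Matrix (Fin (n + 1)) (Fin (n + 1)) ℂ) =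
      blockDiag1 (Z : Matrix (Fin n) (Fin n) ℂ) τ :=
  rfl

/-- Klingen's points `(Z 0; 0 iλ)` are the product points with `τ = iλ`. [cite: Klingen1990, §5 Prop. 1 (2) (p. 55)] -/
theorem coe_prodPoint_I_mul (Z : siegelUpperHalfSpace n) {t : ℝ} (ht : 0 < t) :
    ((prodPoint Z (τ := I * t) (by simpa using ht) : siegelUpperHalfSpace (n + 1)) :
        Matrix (Fin (n + 1)) (Fin (n + 1)) ℂ) = blockDiag1 (Z : Matrix (Fin n) (Fin n) ℂ) (I * t) :=
  rfl

/-- The last column of `(Z 0; 0 τ)`: `τ` at the corner, `0` above. [cite: Klingen1990, §5 Prop. 1 (2) (p. 55)] -/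
private theorem blockDiag1_apply_last (Z : Matrix (Fin n) (Fin n) ℂ) (w : ℂ) (i : Fin (n + 1)) :
    blockDiag1 Z w i (Fin.last n) = if i = Fin.last n then w else 0 := by
  by_cases hi : i = Fin.last n
  · rw [if_pos hi, hi, blockDiag1_apply_last_last]
  · obtain ⟨j, rfl⟩ := Fin.exists_castSucc_eq.2 hi
    rw [if_neg hi, blockDiag1_apply_castSucc_last]

/-- **`Φ_{(Z,τ)}(e_x) = τ · e_{n+1}`** for the last `x`-lattice vector `e_x = e_{inl last}` (the last column of the
period matrix `((Z 0; 0 τ), 1)`). [cite: Lange2023AbelianVarietiesComplex, §3.1.1 (p. 157)] -/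
theorem prinPeriod_prodPoint_single_inl_last (Z : siegelUpperHalfSpace n) {τ : ℂ} (hτ : 0 < τ.im) :
    prinPeriod (prodPoint Z hτ) (Pi.single (Sum.inl (Fin.last n)) 1) =
      fun i ↦ if i = Fin.last n then τ else 0 := by
  ext i
  rw [prinPeriod_apply, coe_prodPoint]
  simp [Pi.single_apply, apply_ite Complex.ofReal, mul_ite, Finset.sum_ite_eq', blockDiag1_apply_last]

/-- **`Φ_{(Z,τ)}(e_y) = e_{n+1}`** for the last `y`-lattice vector `e_y = e_{inr last}`.
[cite: Lange2023AbelianVarietiesComplex, §3.1.1 (p. 157)] -/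
theorem prinPeriod_prodPoint_single_inr_last (Z : siegelUpperHalfSpace n) {τ : ℂ} (hτ : 0 < τ.im) :
    prinPeriod (prodPoint Z hτ) (Pi.single (Sum.inr (Fin.last n)) 1) =
      fun i ↦ if i = Fin.last n then 1 else 0 := by
  ext i
  rw [prinPeriod_apply, coe_prodPoint]
  simp [Pi.single_apply, apply_ite Complex.ofReal]

/-- `Φ_{(Z,τ)}(a e_x + b e_y) = (aτ + b) · e_{n+1}`: the last lattice plane maps onto the last coordinate line
`ℂ · e_{n+1} = 0 × ℂ` (the universal cover of `0 × E_τ`). [cite: Lange2023AbelianVarietiesComplex, §3.1.1 (p. 157)] -/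
theorem prinPeriod_prodPoint_smul_add_smul (Z : siegelUpperHalfSpace n) {τ : ℂ} (hτ : 0 < τ.im) (a b : ℝ) :
    prinPeriod (prodPoint Z hτ) (a • Pi.single (Sum.inl (Fin.last n)) 1 + b • Pi.single (Sum.inr (Fin.last n)) 1) =
      fun i ↦ if i = Fin.last n then (a : ℂ) * τ + b else 0 := by
  rw [map_add, map_smul, map_smul, prinPeriod_prodPoint_single_inl_last, prinPeriod_prodPoint_single_inr_last]
  ext i
  simp only [Pi.add_apply, Pi.smul_apply, Complex.real_smul]
  split_ifs <;> simp

/-- The lattice vector over a point `z` of the last coordinate line: `z = aτ + b` with `a = Im z / Im τ`,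
`b = Re z − a Re τ` (plumbing). [folklore] -/
private def lastLift (n : ℕ) (τ z : ℂ) : Fin (n + 1) ⊕ Fin (n + 1) → ℝ :=
  (z.im / τ.im) • Pi.single (Sum.inl (Fin.last n)) 1 + (z.re - z.im / τ.im * τ.re) • Pi.single (Sum.inr (Fin.last n)) 1

/-- `Φ_{(Z,τ)}(lastLift τ z) = z · e_{n+1}`. [folklore] -/
private theorem prinPeriod_prodPoint_lastLift (Z : siegelUpperHalfSpace n) {τ : ℂ} (hτ : 0 < τ.im) (z : ℂ) :
    prinPeriod (prodPoint Z hτ) (lastLift n τ z) = fun i ↦ if i = Fin.last n then z else 0 := by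
  rw [lastLift, prinPeriod_prodPoint_smul_add_smul]
  ext i
  split_ifs
  · apply Complex.ext
    · simp only [Complex.add_re, Complex.mul_re, Complex.ofReal_re, Complex.ofReal_im, zero_mul, sub_zero]
      ring
    · simp only [Complex.add_im, Complex.mul_im, Complex.ofReal_re, Complex.ofReal_im, zero_mul, add_zero]
      field_simp
  · rfl

/-! ## §2 The product points are of type (i): `0 × E_τ ⊂ X_Z × E_τ` -/

/-- The last lattice plane `ℝe_x ⊕ ℝe_y` (private frame). [folklore] -/
private def lastFrame (n : ℕ) : Fin 2 → (Fin (n + 1) ⊕ Fin (n + 1) → ℝ) :=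
  ![Pi.single (Sum.inl (Fin.last n)) 1, Pi.single (Sum.inr (Fin.last n)) 1]

/-- The last lattice plane is linearly independent. [folklore] -/
private theorem linearIndependent_lastFrame (n : ℕ) : LinearIndependent ℝ (lastFrame n) := by
  have h := (Pi.basisFun ℝ (Fin (n + 1) ⊕ Fin (n + 1))).linearIndependent.comp
    ![Sum.inl (Fin.last n), Sum.inr (Fin.last n)] (fun a b hab ↦ by fin_cases a <;> fin_cases b <;> simp_all)
  convert h using 1
  funext s
  fin_cases s <;> simp [lastFrame]

/-- The last lattice plane is a lattice subspace. [folklore] -/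
private theorem isLatticeSubspace_span_lastFrame (n : ℕ) :
    IsLatticeSubspace (Submodule.span ℝ (Set.range (lastFrame n))) := by
  refine ⟨Set.range ![Pi.single (Sum.inl (Fin.last n)) (1 : ℤ), Pi.single (Sum.inr (Fin.last n)) (1 : ℤ)], ?_⟩
  rw [← Set.range_comp]
  congr 2
  funext s
  fin_cases s <;> simp [lastFrame, intVec_single]

/-- `lastLift` lands in the last lattice plane. [folklore] -/
private theorem lastLift_mem_span (n : ℕ) (τ z : ℂ) : lastLift n τ z ∈ Submodule.span ℝ (Set.range (lastFrame n)) :=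
  Submodule.add_mem _ (Submodule.smul_mem _ _ (Submodule.subset_span ⟨0, rfl⟩))
    (Submodule.smul_mem _ _ (Submodule.subset_span ⟨1, rfl⟩))

/-- The last lattice plane is a complex subspace of `X_Z × E_τ` (`Φ` maps it onto the complex line `0 × ℂ`).
[folklore] -/
private theorem isComplexSubspace_span_lastFrame (Z : siegelUpperHalfSpace n) {τ : ℂ} (hτ : 0 < τ.im) :
    IsComplexSubspace (prinPeriod (prodPoint Z hτ) : (Fin (n + 1) ⊕ Fin (n + 1) → ℝ) ≃L[ℝ] (Fin (n + 1) → ℂ))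
      (Submodule.span ℝ (Set.range (lastFrame n))) := by
  intro v hv
  obtain ⟨c, rfl⟩ := (Submodule.mem_span_range_iff_exists_fun ℝ).1 hv
  have hΦ : prinPeriod (prodPoint Z hτ) (∑ i, c i • lastFrame n i) =
      fun i ↦ if i = Fin.last n then (c 0 : ℂ) * τ + c 1 else 0 := by
    rw [Fin.sum_univ_two]
    exact prinPeriod_prodPoint_smul_add_smul Z hτ (c 0) (c 1)
  have hJ : (prinPeriod (prodPoint Z hτ)).symm (Complex.I • prinPeriod (prodPoint Z hτ) (∑ i, c i • lastFrame n i)) =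
      lastLift n τ (I * ((c 0 : ℂ) * τ + c 1)) := by
    rw [ContinuousLinearEquiv.symm_apply_eq, prinPeriod_prodPoint_lastLift, hΦ]
    ext i
    simp only [Pi.smul_apply, smul_eq_mul]
    split_ifs <;> simp
  rw [hJ]
  exact lastLift_mem_span n τ _

/-- **The product points are of type (i) with `k = 1`: `X_Z × E_τ` contains the elliptic curve `0 × E_τ`.**
[cite: CanningOpreaPandharipande2024, §1.9 Thm. 13 (i) and p. 2 ("𝒜₁ × 𝒜_{g−1} → 𝒜_g is a Noether-Lefschetz locus")] -/
theorem prodPoint_mem_abelianSubvarietyLocus_one (Z : siegelUpperHalfSpace n) {τ : ℂ} (hτ : 0 < τ.im) :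
    prodPoint Z hτ ∈ abelianSubvarietyLocus (n + 1) 1 := by
  refine ⟨Submodule.span ℝ (Set.range (lastFrame n)), isLatticeSubspace_span_lastFrame n,
    isComplexSubspace_span_lastFrame Z hτ, ?_⟩
  rw [finrank_span_eq_card (linearIndependent_lastFrame n), Fintype.card_fin]

/-- **… and of type (i) with `k = n`: `X_Z × E_τ` contains an abelian subvariety of dimension `n`** (the
complementary one, FILE 2's `abelianSubvarietyLocus_eq_of_add_eq`). [cite: CanningOpreaPandharipande2024, §1.9 Thm. 13 (i) (p. 7)] -/
theorem prodPoint_mem_abelianSubvarietyLocus (Z : siegelUpperHalfSpace n) {τ : ℂ} (hτ : 0 < τ.im) :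
    prodPoint Z hτ ∈ abelianSubvarietyLocus (n + 1) n := by
  rw [← abelianSubvarietyLocus_eq_of_add_eq (g := n + 1) (k := 1) (k' := n) (by omega)]
  exact prodPoint_mem_abelianSubvarietyLocus_one Z hτ

/-- **The product locus lies in Debarre–Laszlo's type (i)** (`n ≥ 1`): `X_Z × E_τ` is not simple.
[cite: CanningOpreaPandharipande2024, §1.9 Thm. 13 (i) (p. 7)] -/
theorem prodPoint_mem_nonSimpleLocus (hn : 0 < n) (Z : siegelUpperHalfSpace n) {τ : ℂ} (hτ : 0 < τ.im) :
    prodPoint Z hτ ∈ nonSimpleLocus (n + 1) :=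
  abelianSubvarietyLocus_subset_nonSimpleLocus one_pos (by omega) (prodPoint_mem_abelianSubvarietyLocus_one Z hτ)

/-- **«The product map `𝒜₁ × 𝒜_{g−1} → 𝒜_g` is a Noether-Lefschetz locus»**: every product point has `ρ ≥ 2`
(`n ≥ 1`). [cite: CanningOpreaPandharipande2024, p. 2 and §1.8 (p. 6)] -/
theorem prodPoint_mem_nlLocus (hn : 0 < n) (Z : siegelUpperHalfSpace n) {τ : ℂ} (hτ : 0 < τ.im) :
    prodPoint Z hτ ∈ nlLocus (n + 1) :=
  nonSimpleLocus_subset_nlLocus (prodPoint_mem_nonSimpleLocus hn Z hτ)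

/-- The whole product family `{(Z, τ)}` lies in the type-(i) pieces of dimensions `1` and `n`.
[cite: CanningOpreaPandharipande2024, §1.9 Thm. 13 (i) (p. 7)] -/
theorem prodPoint_mem_inter (Z : siegelUpperHalfSpace n) {τ : ℂ} (hτ : 0 < τ.im) :
    prodPoint Z hτ ∈ abelianSubvarietyLocus (n + 1) 1 ∩ abelianSubvarietyLocus (n + 1) n :=
  ⟨prodPoint_mem_abelianSubvarietyLocus_one Z hτ, prodPoint_mem_abelianSubvarietyLocus Z hτ⟩

/-- `prodPoint` is injective in `Z` (the upper-left block). [cite: Klingen1990, §5 Prop. 1 (2) (p. 55)] -/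
theorem prodPoint_injective {τ : ℂ} (hτ : 0 < τ.im) :
    Function.Injective fun Z : siegelUpperHalfSpace n ↦ prodPoint Z hτ := by
  intro Z W h
  apply Subtype.ext
  ext i j
  have hij := congrArg (fun P : siegelUpperHalfSpace (n + 1) ↦
    (P : Matrix (Fin (n + 1)) (Fin (n + 1)) ℂ) (Fin.castSucc i) (Fin.castSucc j)) h
  simpa [prodPoint, Literature.NumberTheory.ModularForms.SiegelModularForm.blockDiag1_apply_castSucc_castSucc]
    using hij

end SiegelModuli

end Literature.AlgebraicGeometry.ModuliOfAbelianVarieties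

end
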